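import Summits.BirchSwinnertonDyer.BirchSwinnertonDyer.Theorems.PrintCf2RubinValueTwoFourTermCFTPrelim
import HarnessLib

/-!
# The four-term sequence of class field theory at a finite level, III: the image — principal units map onto
# inertia in a `p`-power extension, so `X_S(K)/im(U_S) = A(K)`

Cell `bsd-print-cf2` (HOME `run/shared/lean/pub/bsd-print-cf2/`), seat `bsd-line-cf2c-w6` g3, brick §4(d)
«four-term sequence `0 → Ē_∞ → U_v → 𝒳^{(v)} → A_∞ → 0` (CFT over `𝔎_∞L′`)» of LEAD memo
`Cruxes/SplitBadTwoRankOneOfFacts/RULING-B23-g13.md` §4, crux of record stmt-BirchSwinnertonDyer-24033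
`PrintCf2RubinValueTwo.TwoVariableMainConjAtSplitTwoQuad`. Third file of the finite-level four-term CFT brick
(`…FourTermCFTPrelim`, `…FourTermCFTKernel`, `…FourTermCFTUnitsDie`): the RIGHT end of the sequence. The tree
already proves Lang XI §4 Thm. 4 «`[⟨𝒪_wˣ⟩_w, K]|_L =` inertia at `w`» (`map_absRestrictNormalHom_inertia_eq`,
`isUnramifiedIn_iff_forall_localUnits_mem_normGroup`); the four-term sequence maps only the PRINCIPAL units
`U¹_w` (the pro-`p` part), so we add the `p`-power refinement:

* `not_dvd_card_residueField_sub_one`: at `w ∣ p`, `p ∤ q_w − 1` (`q_w = #𝓀(w)`, residue characteristic `p`);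
* `valued_pow_card_residueField_sub_one_sub_one_lt`: `u^{q_w−1} ∈ U¹_w` for every local unit `u`;
* `isUnramifiedIn_of_forall_principal_localUnits_mem_normGroup`: for a finite abelian `L ⊆ K̄` of `p`-POWER
  degree and `w ∣ p`, if every `⟨u⟩_w`, `u ∈ U¹_w`, lies in `𝒩_L` then `L` is unramified at `w` (Bezout between
  `q_w − 1` and `[𝕀_K : 𝒩_L] = [L:K] = p^n`, the tree's `index_normGroup_eq_finrank_of_isAbelianGalois`);
* `forall_isUnramifiedIn_iff_forall_principal_localUnits_mem_normGroup` (**the cokernel**): for `L` of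
  `p`-power degree unramified outside `S ⊆ {w ∣ p}`: `L` is everywhere unramified (⊆ the `p`-Hilbert class
  field; `Gal(L/K)` a quotient of `A(K)`) iff the principal semi-local units `U_S` die in `G(L|K)` — i.e.
  `X_S(K)/im(U_S) = A(K)` (de Shalit III.1.3, Washington 13.4);
* `prod_localUnits_mem_normGroup_of_forall_isUnramifiedIn`: the composite `U_S → X_S(K) → A(K)` is zero.

No `sorry`, no definition, no named fact; Theses-free. No summit statement is proved; BSD is not advanced here.

## References
* [LangANT1994] S. Lang, *Algebraic Number Theory*, Ch. XI §4 Thm. 4.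
* [deShalit1987] E. de Shalit, *Iwasawa theory of elliptic curves with complex multiplication*, Ch. III §1.3.
* [Washington1997] L. Washington, *Introduction to Cyclotomic Fields*, GTM 83, Thm. 13.4.
* [CasselsFrohlichANT1967] J. Tate, Ch. VII §5.1 (B).
-/

noncomputable section

set_option linter.dupNamespace false -- D-0017: single-problem summit, `…BirchSwinnertonDyer.BirchSwinnertonDyer…` repeats a namespace by design
set_option autoImplicit false

open NumberField IsDedekindDomain IsDedekindDomain.HeightOneSpectrum WithZero
open scoped nonZeroDivisors Topology
open Literature.NumberTheory Literature.NumberTheory.NumberFields Literature.NumberTheory.GaloisRepresentations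

namespace Summit.BirchSwinnertonDyer.BirchSwinnertonDyer.Theorems.PrintCf2.FourTermCFT

/-! ### The image: principal units and inertia in a `p`-power extension -/

section Image

variable {K : Type} [Field K] [NumberField K]

/-- At a place `w ∣ p` the residue characteristic is `p`: `p ∤ q_w − 1` for `q_w = #𝓀(w)`. [folklore] -/
theorem not_dvd_card_residueField_sub_one {p : ℕ} (w : HeightOneSpectrum (𝓞 K))
    (hw : ((p : ℕ) : 𝓞 K) ∈ w.asIdeal)
    [Fintype (IsLocalRing.ResidueField (w.adicCompletionIntegers K))] :
    ¬ p ∣ Fintype.card (IsLocalRing.ResidueField (w.adicCompletionIntegers K)) - 1 := by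
  have hq : (Fintype.card (IsLocalRing.ResidueField (w.adicCompletionIntegers K)) :
      IsLocalRing.ResidueField (w.adicCompletionIntegers K)) = 0 := FiniteField.cast_card_eq_zero _
  -- `p ∈ 𝔪_w`, so `(p : 𝓀(w)) = 0`
  have hpk : ((p : ℕ) : IsLocalRing.ResidueField (w.adicCompletionIntegers K)) = 0 := by
    rw [← map_natCast (IsLocalRing.residue (w.adicCompletionIntegers K)), IsLocalRing.residue_eq_zero_iff,
      IsLocalRing.mem_maximalIdeal, mem_nonunits_iff]
    refine Valuation.Integer.not_isUnit_iff_valuation_lt_one.mpr ?_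
    have h := valued_natCast_lt_one (K := K) w hw
    rwa [show ((p : ℕ) : w.adicCompletion K) =
      (w.adicCompletionIntegers K).subtype (p : w.adicCompletionIntegers K) by rw [map_natCast]] at h
  rintro ⟨t, ht⟩
  have h1 : ((Fintype.card (IsLocalRing.ResidueField (w.adicCompletionIntegers K)) - 1 : ℕ) :
      IsLocalRing.ResidueField (w.adicCompletionIntegers K)) = 0 := by
    rw [ht, Nat.cast_mul, hpk, zero_mul]
  have hpos : 1 ≤ Fintype.card (IsLocalRing.ResidueField (w.adicCompletionIntegers K)) := Fintype.card_pos
  have h2 : ((Fintype.card (IsLocalRing.ResidueField (w.adicCompletionIntegers K)) : ℕ) :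
      IsLocalRing.ResidueField (w.adicCompletionIntegers K)) =
      ((Fintype.card (IsLocalRing.ResidueField (w.adicCompletionIntegers K)) - 1 : ℕ) :
        IsLocalRing.ResidueField (w.adicCompletionIntegers K)) + 1 := by
    rw [← Nat.cast_add_one, Nat.sub_add_cancel hpos]
  rw [hq, h1, zero_add] at h2
  exact zero_ne_one h2

/-- A local unit of `K_w` raised to `q_w − 1` is a principal unit (`𝒪_wˣ → 𝓀(w)ˣ` has kernel `U¹_w`,
and `𝓀(w)ˣ` has order `q_w − 1`). [folklore] -/
theorem valued_pow_card_residueField_sub_one_sub_one_lt (w : HeightOneSpectrum (𝓞 K))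
    [Fintype (IsLocalRing.ResidueField (w.adicCompletionIntegers K))]
    (u : (w.adicCompletion K)ˣ) (hu : Valued.v (u : w.adicCompletion K) = 1) :
    Valued.v ((u : w.adicCompletion K) ^ (Fintype.card (IsLocalRing.ResidueField (w.adicCompletionIntegers K)) - 1)
      - 1) < 1 := by
  -- lift `u` to a unit `u'` of `𝒪_w`
  have hu' : Valued.v ((u⁻¹ : (w.adicCompletion K)ˣ) : w.adicCompletion K) = 1 := by
    rw [Units.val_inv_eq_inv_val, map_inv₀, hu, inv_one]
  let u' : (w.adicCompletionIntegers K)ˣ :=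
    ⟨⟨(u : w.adicCompletion K), hu.le⟩, ⟨((u⁻¹ : (w.adicCompletion K)ˣ) : w.adicCompletion K), hu'.le⟩,
      Subtype.ext (Units.mul_inv u), Subtype.ext (Units.inv_mul u)⟩
  have hmax : ∀ z : w.adicCompletionIntegers K,
      z ∈ IsLocalRing.maximalIdeal (w.adicCompletionIntegers K) ↔ Valued.v (z : w.adicCompletion K) < 1 :=
    fun z => by
      rw [IsLocalRing.mem_maximalIdeal, mem_nonunits_iff]
      exact Valuation.Integer.not_isUnit_iff_valuation_lt_one
  have hres : IsLocalRing.residue (w.adicCompletionIntegers K)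
      (((u' ^ (Fintype.card (IsLocalRing.ResidueField (w.adicCompletionIntegers K)) - 1) :
        (w.adicCompletionIntegers K)ˣ) : w.adicCompletionIntegers K) - 1) = 0 := by
    rw [map_sub, Units.val_pow_eq_pow_val, map_pow,
      FiniteField.pow_card_sub_one_eq_one _ ((IsLocalRing.residue_ne_zero_iff_isUnit _).2 (Units.isUnit u')),
      map_one, sub_self]
  rw [IsLocalRing.residue_eq_zero_iff, hmax] at hres
  have hcoe : ((((u' ^ (Fintype.card (IsLocalRing.ResidueField (w.adicCompletionIntegers K)) - 1) :
      (w.adicCompletionIntegers K)ˣ) : w.adicCompletionIntegers K) - 1 : w.adicCompletionIntegers K) :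
        w.adicCompletion K) =
      (u : w.adicCompletion K) ^ (Fintype.card (IsLocalRing.ResidueField (w.adicCompletionIntegers K)) - 1) - 1 := by
    rw [Units.val_pow_eq_pow_val]
    push_cast
    rfl
  rwa [hcoe] at hres

/-- **Principal units detect ramification in a `p`-power extension** (the `U¹_w`-refinement of Lang XI §4
Thm. 4 «`v` unramified iff `U_v ⊂ H`»): for a finite abelian `L ⊆ K̄` of `p`-power degree and a place `w ∣ p`,
if every PRINCIPAL local unit `⟨u⟩_w`, `u ∈ U¹_w`, lies in `𝒩_L`, then `L` is unramified at `w` — since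
`𝒪_wˣ/U¹_w ≅ 𝓀(w)ˣ` has order `q_w − 1` prime to `p` while `𝕀_K/𝒩_L ≅ G(L|K)` is a `p`-group (Bezout).
This is the «image» end of the four-term sequence: `U_S → X_S(K)` maps onto the inertia, i.e.
`X_S(K)/im U_S = A(K)` (the everywhere-unramified quotient). [cite: LangANT1994, Ch. XI §4 Thm. 4]
[cite: deShalit1987, III.1.3] [cite: Washington1997, Thm. 13.4] -/
theorem isUnramifiedIn_of_forall_principal_localUnits_mem_normGroup {p : ℕ} [hp : Fact p.Prime]
    (L : IntermediateField K (AlgebraicClosure K)) [FiniteDimensional K L] [IsAbelianGalois K L] [NumberField L]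
    (hdeg : ∃ n, Module.finrank K L = p ^ n) (w : HeightOneSpectrum (𝓞 K)) (hw : ((p : ℕ) : 𝓞 K) ∈ w.asIdeal)
    (h : ∀ u : (w.adicCompletion K)ˣ, Valued.v ((u : w.adicCompletion K) - 1) < 1 →
      localUnits w u ∈ Automorphic.normGroup K L) :
    Algebra.IsUnramifiedIn (𝓞 L) w.asIdeal := by
  classical
  rw [isUnramifiedIn_iff_forall_localUnits_mem_normGroup L w]
  intro u hu
  haveI : Finite (IsLocalRing.ResidueField (w.adicCompletionIntegers K)) :=
    Automorphic.finite_residueField_adicCompletion K w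
  letI : Fintype (IsLocalRing.ResidueField (w.adicCompletionIntegers K)) := Fintype.ofFinite _
  set q : ℕ := Fintype.card (IsLocalRing.ResidueField (w.adicCompletionIntegers K)) with hq
  obtain ⟨n, hn⟩ := hdeg
  -- `⟨u⟩_w^{q-1} ∈ 𝒩_L` (principal unit) and `⟨u⟩_w^{p^n} ∈ 𝒩_L` (`[𝕀_K : 𝒩_L] = [L:K] = p^n`)
  have h1 : localUnits w u ^ (q - 1) ∈ Automorphic.normGroup K L := by
    rw [← map_pow]
    refine h _ ?_
    rw [Units.val_pow_eq_pow_val]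
    exact valued_pow_card_residueField_sub_one_sub_one_lt w u hu
  have h2 : localUnits w u ^ p ^ n ∈ Automorphic.normGroup K L := by
    rw [← hn, ← index_normGroup_eq_finrank_of_isAbelianGalois K L]
    exact Subgroup.pow_index_mem _ _
  refine mem_of_pow_mem_of_coprime _ (Nat.Coprime.pow_right n ?_) h1 h2
  exact (Nat.Prime.coprime_iff_not_dvd hp.out).2 (not_dvd_card_residueField_sub_one w hw) |>.symm

/-- **THE COKERNEL OF THE FOUR-TERM SEQUENCE AT A FINITE LEVEL**: for a finite abelian `L ⊆ K̄` of `p`-power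
degree unramified outside a finite set `S` of places above `p`, `L` is unramified EVERYWHERE (i.e. `L` lies in
the `p`-Hilbert class field, `Gal(L/K)` is a quotient of `A(K)`) iff the principal semi-local units die in
`G(L|K)`: `⟨u⟩_w ∈ 𝒩_L` for all `w ∈ S`, `u ∈ U¹_w`. («`X_S(K)/im(U_S) = Gal(H_p(K)/K) = A(K)`»,
de Shalit III.1.3; Washington Thm. 13.4.) [cite: deShalit1987, III.1.3] [cite: Washington1997, Thm. 13.4]
[cite: LangANT1994, Ch. XI §4 Thm. 4] -/
theorem forall_isUnramifiedIn_iff_forall_principal_localUnits_mem_normGroup {p : ℕ} [Fact p.Prime]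
    (S : Finset (HeightOneSpectrum (𝓞 K))) (hS : ∀ w ∈ S, ((p : ℕ) : 𝓞 K) ∈ w.asIdeal)
    (L : IntermediateField K (AlgebraicClosure K)) [FiniteDimensional K L] [IsAbelianGalois K L] [NumberField L]
    (hdeg : ∃ n, Module.finrank K L = p ^ n)
    (hunr : ∀ w : HeightOneSpectrum (𝓞 K), w ∉ S → Algebra.IsUnramifiedIn (𝓞 L) w.asIdeal) :
    (∀ w : HeightOneSpectrum (𝓞 K), Algebra.IsUnramifiedIn (𝓞 L) w.asIdeal) ↔
      ∀ w ∈ S, ∀ u : (w.adicCompletion K)ˣ, Valued.v ((u : w.adicCompletion K) - 1) < 1 →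
        localUnits w u ∈ Automorphic.normGroup K L := by
  constructor
  · intro hall w _ u hu
    refine (isUnramifiedIn_iff_forall_localUnits_mem_normGroup L w).1 (hall w) u ?_
    have := Valuation.map_one_add_of_lt Valued.v hu
    rwa [add_sub_cancel] at this
  · intro h w
    by_cases hw : w ∈ S
    · exact isUnramifiedIn_of_forall_principal_localUnits_mem_normGroup L hdeg w (hS w hw) (h w hw)
    · exact hunr w hw

/-- The image end for the idèles `ι_S(y)`: if `L` (finite abelian, unramified outside `S`) is unramified
everywhere, then EVERY `ι_S(y) = ∏_{w∈S} ⟨y_w⟩_w` with local units `y_w` lies in `𝒩_L` — the composite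
`U_S → X_S(K) → A(K)` is zero. [cite: deShalit1987, III.1.3] [cite: LangANT1994, Ch. XI §4 Thm. 4] -/
theorem prod_localUnits_mem_normGroup_of_forall_isUnramifiedIn (S : Finset (HeightOneSpectrum (𝓞 K)))
    (L : IntermediateField K (AlgebraicClosure K)) [FiniteDimensional K L] [IsAbelianGalois K L] [NumberField L]
    (hall : ∀ w : HeightOneSpectrum (𝓞 K), Algebra.IsUnramifiedIn (𝓞 L) w.asIdeal)
    (y : (w : HeightOneSpectrum (𝓞 K)) → (w.adicCompletion K)ˣ)
    (hy : ∀ w ∈ S, Valued.v ((y w : w.adicCompletion K)) = 1) :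
    (∏ w ∈ S, localUnits w (y w)) ∈ Automorphic.normGroup K L :=
  Subgroup.prod_mem _ fun w hw =>
    (isUnramifiedIn_iff_forall_localUnits_mem_normGroup L w).1 (hall w) (y w) (hy w hw)

end Image

end Summit.BirchSwinnertonDyer.BirchSwinnertonDyer.Theorems.PrintCf2.FourTermCFT
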